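import Literature.Analysis.FluidPDE.NSLocalAnalyticityRadiusLocalisation
import Literature.Analysis.FluidPDE.NewtonGradientPotential
import HarnessLib

/-!
# The localised field of a cylinder solution: regularity, support, divergence, time derivative

Analysis/FluidPDE proofs-layer file (theorems only), module L1 of the proof of the named fact
`Literature.Analysis.FluidPDE.bradshawGrujicKukavica2015_local_analyticity_radius`
(Bradshaw–Grujić–Kukavica 2015, Thm. 2.3, §4). For a classical solution `(u, p)` on the open
cylinder `(-δ, R²) × B(x₁, R)` (`BGK2015.IsCylinderSolution`) and an admissible cut-off `χ`
(`BGK2015.IsLocCutoff`, supported in `B̄(x₁, R - 3)`, `≡ 1` on `B̄(x₁, R - 4)`), the localised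
objects of `NSLocalAnalyticityRadiusLocalisation.lean` satisfy, at every time `t ∈ (-δ, R²)`:

* `v(t) = χu(t) ∈ C_c^∞(ℝ³)` with `supp v(t) ⊆ B̄(x₁, R - 3)` (`contDiff_locVelocity`,
  `tsupport_locVelocity_subset`), jointly smooth in `(t, x)` on `(-δ, R²) × ℝ³`
  (`contDiffOn_uncurry_locVelocity`);
* `div v(t) = ∇χ · u(t)` (`divergence_locVelocity`, by `div u = 0`), a `C_c^∞` function;
* the commutator force `f₀(t) = (Δχ)u + (u·∇χ)u + p∇χ ∈ C_c^∞(ℝ³)`, supported in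
  `B̄(x₁, R - 3)`;
* the time derivative: `∂ₜv(t, x) = χ(x) ∂ₜu(t, x) = χ(x) (Δu - (u·∇)u - ∇p)(t, x)`
  (`hasDerivAt_locVelocity`, `deriv_locVelocity_eq`);
* the bounded extension `ũ(t) = 1_{B(x₁,R-2)} u(t)` agrees with `u(t)` on `supp χ`, and
  `v(t) ⊗ ũ(t)`-type products only see `u`;
* the Leray–Helmholtz parts `a(t) = P[v(t)]`, `b(t) = ∇π[v(t)]` are smooth, `div a(t) = 0`, and
  **`b(t)` is the frame sum of the gradient potentials of `div v(t)`**: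
  `b(t, x) = ∑ⱼ T_{eⱼ}(div v(t))(x) eⱼ`, `T_a g(x) = ∫ ∂_aΓ(x - y) g(y) dy`
  (`locGradPart_eq_sum_newtonGradPotential`; derivatives of `π[v] = Γ ⋆ div v` fall on the
  source and are moved back onto the kernel, Gilbarg–Trudinger Lemma 4.1) — the form continued
  holomorphically in `NewtonGradKernelComplex.lean`.

## Mathlib / tree search

Tree: `divPotential_apply`, `contDiff_divPotential`, `contDiff_classicalLerayProj`,
`isDivFree_classicalLerayProj` (`ClassicalLerayProjection`); `fderiv_convolution_newtonKernel_apply`,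
`convolution_newtonKernel_apply'` (`NewtonPotentialTestSource`); `integral_newtonKernel_smul_fderiv_eq`
(`BiotSavartNewtonKernel`); `newtonGradPotential` (`NewtonGradientPotential`);
`divergence_smul_apply`, `gradient_eq_zero_of_notMem_tsupport`,
`laplacian_eq_zero_of_notMem_tsupport` (`WholeSpaceIBP`). Mathlib: `fderiv_of_notMem_tsupport`,
`notMem_tsupport_iff_eventuallyEq`, `tsupport_smul_subset_left`, `OrthonormalBasis.sum_repr'`.

## References

* Z. Bradshaw, Z. Grujić, I. Kukavica, J. Differential Equations 259 (2015), §4, (4.1)–(4.3).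
  [BradshawGrujicKukavica2015]
* D. Gilbarg, N. S. Trudinger, *Elliptic PDE of Second Order* (2001), Lemma 4.1.
  [GilbargTrudinger2001]
-/

noncomputable section

open MeasureTheory Set Function Filter Metric Real
open _root_.Topology
open scoped ENNReal ContDiff Laplacian InnerProductSpace RealInnerProductSpace Convolution

namespace Literature.Analysis.FluidPDE

namespace BGK2015

variable {x₁ : EuclideanSpace ℝ (Fin 3)} {δ R : ℝ}
  {u : ℝ → EuclideanSpace ℝ (Fin 3) → EuclideanSpace ℝ (Fin 3)}
  {p : ℝ → EuclideanSpace ℝ (Fin 3) → ℝ} {χ : EuclideanSpace ℝ (Fin 3) → ℝ}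

/-! ### Gluing: smooth on an open set and zero near every other point -/

/-- A function which is `Cⁿ` on an open set `O` and vanishes near every point off `O` is `Cⁿ`
on the whole space. [folklore] -/
theorem contDiff_of_contDiffOn_of_eventuallyEq_zero {X F : Type*} [NormedAddCommGroup X]
    [NormedSpace ℝ X] [NormedAddCommGroup F] [NormedSpace ℝ F] {n : WithTop ℕ∞} {O : Set X}
    (hO : IsOpen O) {f : X → F} (hf : ContDiffOn ℝ n f O)
    (h0 : ∀ x ∉ O, f =ᶠ[𝓝 x] fun _ => 0) : ContDiff ℝ n f := by
  rw [contDiff_iff_contDiffAt]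
  intro x
  by_cases hx : x ∈ O
  · exact hf.contDiffAt (hO.mem_nhds hx)
  · exact contDiffAt_const.congr_of_eventuallyEq (h0 x hx)

/-- Off the support of the cut-off, the cut-off and all its derivatives vanish near the point:
`χ`, `Dχ`, `∇χ`, `Δχ` are eventually `0`. [folklore] -/
theorem IsLocCutoff.eventually_derivs_eq_zero (hχ : IsLocCutoff x₁ R χ)
    {x : EuclideanSpace ℝ (Fin 3)} (hx : x ∉ tsupport χ) :
    ∀ᶠ y in 𝓝 x, χ y = 0 ∧ fderiv ℝ χ y = 0 ∧ gradient χ y = 0 ∧ (Δ χ) y = 0 := by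
  have _ := hχ
  have hopen : IsOpen (tsupport χ)ᶜ := (isClosed_tsupport χ).isOpen_compl
  filter_upwards [hopen.mem_nhds hx] with y hy
  exact ⟨image_eq_zero_of_notMem_tsupport hy, fderiv_of_notMem_tsupport ℝ hy,
    gradient_eq_zero_of_notMem_tsupport hy, laplacian_eq_zero_of_notMem_tsupport hy⟩

/-- Points off the data ball are off the support of the cut-off. [folklore] -/
theorem IsLocCutoff.notMem_tsupport_of_notMem_ball (hχ : IsLocCutoff x₁ R χ)
    {x : EuclideanSpace ℝ (Fin 3)} (hx : x ∉ ball x₁ R) : x ∉ tsupport χ :=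
  fun h => hx (hχ.tsupport_subset_ball' h)

/-! ### The localised velocity at a fixed time -/

section Slice

variable (hsol : IsCylinderSolution x₁ δ R u p) (hχ : IsLocCutoff x₁ R χ) {t : ℝ}
  (ht : t ∈ Ioo (-δ) (R ^ 2))
include hsol hχ ht

/-- **`v(t) ∈ C^∞(ℝ³)`**. [folklore] -/
theorem contDiff_locVelocity : ContDiff ℝ ∞ (locVelocity χ u t) := by
  refine contDiff_of_contDiffOn_of_eventuallyEq_zero isOpen_ball
    (hχ.contDiff.contDiffOn.smul (hsol.contDiffOn_velocity_slice ht)) fun x hx => ?_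
  filter_upwards [hχ.eventually_derivs_eq_zero (hχ.notMem_tsupport_of_notMem_ball hx)] with y hy
  rw [locVelocity_apply, hy.1, zero_smul]

/-- The pressure slice localised by any derivative of the cut-off is globally smooth; here the
instance needed below: `x ↦ p(t, x) ∇χ(x) ∈ C^∞`. [folklore] -/
theorem contDiff_pressure_smul_gradient : ContDiff ℝ ∞ fun x => p t x • gradient χ x := by
  refine contDiff_of_contDiffOn_of_eventuallyEq_zero isOpen_ball
    ((hsol.contDiffOn_pressure_slice ht).smul
      (contDiff_gradient_of_contDiff_top hχ.contDiff).contDiffOn) fun x hx => ?_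
  · filter_upwards [hχ.eventually_derivs_eq_zero (hχ.notMem_tsupport_of_notMem_ball hx)] with y hy
    rw [hy.2.2.1, smul_zero]

/-- **`f₀(t) ∈ C^∞(ℝ³)`**. [folklore] -/
theorem contDiff_locForce : ContDiff ℝ ∞ (locForce χ u p t) := by
  have hu := hsol.contDiffOn_velocity_slice ht
  have hΔχ : ContDiff ℝ ∞ (Δ χ) := contDiff_laplacian (n := (⊤ : ℕ∞)) (by exact_mod_cast hχ.contDiff)
  have h1 : ContDiffOn ℝ ∞ (fun x => (Δ χ) x • u t x) (ball x₁ R) := hΔχ.contDiffOn.smul hu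
  have h2 : ContDiffOn ℝ ∞ (fun x => (fderiv ℝ χ x (u t x)) • u t x) (ball x₁ R) :=
    ((hχ.contDiff.fderiv_right (m := ∞) le_rfl).contDiffOn.clm_apply hu).smul hu
  have h3 : ContDiffOn ℝ ∞ (fun x => p t x • gradient χ x) (ball x₁ R) :=
    (contDiff_pressure_smul_gradient hsol hχ ht).contDiffOn
  refine contDiff_of_contDiffOn_of_eventuallyEq_zero isOpen_ball ((h1.add h2).add h3)
    fun x hx => ?_
  filter_upwards [hχ.eventually_derivs_eq_zero (hχ.notMem_tsupport_of_notMem_ball hx)] with y hy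
  simp [locForce_apply, hy.2.1, hy.2.2.1, hy.2.2.2]

omit hsol ht in
/-- **`supp v(t) ⊆ B̄(x₁, R - 3)`**. [folklore] -/
theorem tsupport_locVelocity_subset : tsupport (locVelocity χ u t) ⊆ closedBall x₁ (R - 3) :=
  (tsupport_smul_subset_left χ (u t)).trans hχ.tsupport_subset

omit hsol ht in
/-- `v(t)` has compact support. [folklore] -/
theorem hasCompactSupport_locVelocity : HasCompactSupport (locVelocity χ u t) :=
  HasCompactSupport.of_support_subset_isCompact (isCompact_closedBall x₁ (R - 3))
    ((subset_tsupport _).trans (tsupport_locVelocity_subset hχ))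

omit hsol ht in
/-- **`supp f₀(t) ⊆ B̄(x₁, R - 3)`** (every term carries a derivative of `χ`). [folklore] -/
theorem tsupport_locForce_subset : tsupport (locForce χ u p t) ⊆ closedBall x₁ (R - 3) := by
  refine closure_minimal (fun x hx => ?_) isClosed_closedBall
  by_contra hx'
  have hxs : x ∉ tsupport χ := fun h => hx' (hχ.tsupport_subset h)
  obtain ⟨h1, h2, h3, h4⟩ := (hχ.eventually_derivs_eq_zero hxs).self_of_nhds
  exact hx (by simp [locForce_apply, h2, h3, h4])

omit hsol ht in
/-- `f₀(t)` has compact support. [folklore] -/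
theorem hasCompactSupport_locForce : HasCompactSupport (locForce χ u p t) :=
  HasCompactSupport.of_support_subset_isCompact (isCompact_closedBall x₁ (R - 3))
    ((subset_tsupport _).trans (tsupport_locForce_subset hχ))

/-- **`div v(t) = ∇χ · u(t)`** everywhere (inside the ball by the Leibniz rule and `div u = 0`,
outside both sides vanish). [cite: BradshawGrujicKukavica2015, §4 (4.3)] -/
theorem divergence_locVelocity (x : EuclideanSpace ℝ (Fin 3)) :
    VectorCalculus.divergence (locVelocity χ u t) x = locDivergence χ u t x := by
  by_cases hx : x ∈ ball x₁ R
  · have hud : DifferentiableAt ℝ (u t) x :=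
      ((hsol.contDiffOn_velocity_slice ht).differentiableOn (by simp)).differentiableAt
        (isOpen_ball.mem_nhds hx)
    rw [locVelocity_eq_fun, divergence_smul_apply (hχ.contDiff.differentiable (by simp) x) hud,
      hsol.divFree t ht x hx, mul_zero, zero_add, locDivergence_apply, real_inner_comm, gradient,
      InnerProductSpace.toDual_symm_apply]
  · have hxs := hχ.notMem_tsupport_of_notMem_ball hx
    have hxv : x ∉ tsupport (locVelocity χ u t) := fun h =>
      hxs ((tsupport_smul_subset_left χ (u t)) h)
    rw [divergence_eq_zero_of_notMem_tsupport hxv, locDivergence_apply,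
      fderiv_of_notMem_tsupport ℝ hxs]
    rfl

/-- The same as functions. [folklore] -/
theorem divergence_locVelocity_eq :
    VectorCalculus.divergence (locVelocity χ u t) = locDivergence χ u t :=
  funext (divergence_locVelocity hsol hχ ht)

/-- **`div v(t) ∈ C_c^∞`**. [folklore] -/
theorem contDiff_locDivergence : ContDiff ℝ ∞ (locDivergence χ u t) := by
  rw [← divergence_locVelocity_eq hsol hχ ht]
  exact contDiff_divergence_of_contDiff_top (contDiff_locVelocity hsol hχ ht)

omit hsol ht in
/-- `supp (∇χ · u(t)) ⊆ B̄(x₁, R - 3)`. [folklore] -/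
theorem tsupport_locDivergence_subset : tsupport (locDivergence χ u t) ⊆ closedBall x₁ (R - 3) := by
  refine closure_minimal (fun x hx => ?_) isClosed_closedBall
  by_contra hx'
  have hxs : x ∉ tsupport χ := fun h => hx' (hχ.tsupport_subset h)
  exact hx (by simp [locDivergence_apply, fderiv_of_notMem_tsupport ℝ hxs])

omit hsol ht in
/-- `∇χ · u(t)` has compact support. [folklore] -/
theorem hasCompactSupport_locDivergence : HasCompactSupport (locDivergence χ u t) :=
  HasCompactSupport.of_support_subset_isCompact (isCompact_closedBall x₁ (R - 3))
    ((subset_tsupport _).trans (tsupport_locDivergence_subset hχ))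

omit hsol ht in
/-- `∇χ · u(t)` vanishes on the inner ball `B(x₁, R - 4)` (where `χ ≡ 1`). [folklore] -/
theorem locDivergence_eq_zero_of_mem {x : EuclideanSpace ℝ (Fin 3)} (hx : x ∈ ball x₁ (R - 4)) :
    locDivergence χ u t x = 0 := by
  rw [locDivergence_apply, hχ.fderiv_eq_zero_of_mem hx]
  rfl

omit hsol ht in
/-- **On the support of the cut-off the bounded extension is the velocity**: `ũ(t) = u(t)` on
`supp χ` (`⊆ B̄(x₁, R - 3) ⊆ B(x₁, R - 2)`). [folklore] -/
theorem locExtension_eq_of_mem_tsupport {x : EuclideanSpace ℝ (Fin 3)} (hx : x ∈ tsupport χ) :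
    locExtension x₁ R u t x = u t x :=
  locExtension_of_mem (hχ.tsupport_subset_ball hx) u t

omit hsol ht in
/-- `v(t) = χ ũ(t)` everywhere. [folklore] -/
theorem locVelocity_eq_smul_locExtension (x : EuclideanSpace ℝ (Fin 3)) :
    locVelocity χ u t x = χ x • locExtension x₁ R u t x := by
  by_cases hx : x ∈ tsupport χ
  · rw [locVelocity_apply, locExtension_eq_of_mem_tsupport hχ hx]
  · rw [locVelocity_apply, image_eq_zero_of_notMem_tsupport hx, zero_smul, zero_smul]

/-! ### The Leray–Helmholtz parts at a fixed time -/

/-- `π[v(t)] ∈ C^∞`. [folklore] -/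
theorem contDiff_locPotential : ContDiff ℝ ∞ (locPotential χ u t) :=
  contDiff_divPotential (contDiff_locVelocity hsol hχ ht) (hasCompactSupport_locVelocity hχ)

/-- `b(t) = ∇π[v(t)] ∈ C^∞`. [folklore] -/
theorem contDiff_locGradPart : ContDiff ℝ ∞ (locGradPart χ u t) :=
  contDiff_gradient_of_contDiff_top (contDiff_locPotential hsol hχ ht)

/-- `a(t) = P[v(t)] ∈ C^∞`. [folklore] -/
theorem contDiff_locSolPart : ContDiff ℝ ∞ (locSolPart χ u t) :=
  contDiff_classicalLerayProj (contDiff_locVelocity hsol hχ ht) (hasCompactSupport_locVelocity hχ)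

/-- **`div a(t) = 0`**. [cite: MajdaBertozziCUP2002, §1.8 Prop. 1.16 (1.91)] -/
theorem isDivFree_locSolPart : VectorCalculus.IsDivFree (locSolPart χ u t) :=
  isDivFree_classicalLerayProj (contDiff_locVelocity hsol hχ ht) (hasCompactSupport_locVelocity hχ)

/-- **`Δπ[v(t)] = div v(t) = ∇χ · u(t)`**. [cite: GilbargTrudinger2001, Lemma 4.2] -/
theorem laplacian_locPotential (x : EuclideanSpace ℝ (Fin 3)) :
    (Δ (locPotential χ u t)) x = locDivergence χ u t x := by
  rw [locPotential_eq, laplacian_divPotential (contDiff_locVelocity hsol hχ ht)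
    (hasCompactSupport_locVelocity hχ), divergence_locVelocity hsol hχ ht]

/-- **Derivatives of the potential are gradient potentials of the divergence**:
`∂_a π[v(t)](x) = T_a(div v(t))(x) = ∫ ∂_aΓ(x - y) (∇χ·u(t))(y) dy` (the derivative falls on the
source, `fderiv_convolution_newtonKernel_apply`, and is moved back onto the kernel,
`integral_newtonKernel_smul_fderiv_eq`). [cite: GilbargTrudinger2001, Lemma 4.1] -/
theorem fderiv_locPotential_apply (x a : EuclideanSpace ℝ (Fin 3)) :
    fderiv ℝ (locPotential χ u t) x a = newtonGradPotential a (locDivergence χ u t) x := by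
  have hg : ContDiff ℝ ∞ (locDivergence χ u t) := contDiff_locDivergence hsol hχ ht
  have hgc : HasCompactSupport (locDivergence χ u t) := hasCompactSupport_locDivergence hχ
  have h1 : locPotential χ u t = (locDivergence χ u t) ⋆[ContinuousLinearMap.lsmul ℝ ℝ, volume]
      newtonKernel := by
    rw [locPotential_eq, divPotential, divergence_locVelocity_eq hsol hχ ht]
  rw [h1, fderiv_convolution_newtonKernel_apply (hg.of_le (by norm_cast)) hgc,
    convolution_newtonKernel_apply', newtonGradPotential]
  have h2 := integral_newtonKernel_smul_fderiv_eq (F := ℝ) (hg.of_le (by norm_cast)) hgc x a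
  simp only [smul_eq_mul] at h2 ⊢
  exact h2

/-- **`b(t)` is the frame sum of the gradient potentials of `div v(t)`**:
`b(t, x) = ∑ⱼ T_{eⱼ}(∇χ·u(t))(x) eⱼ`. [cite: GilbargTrudinger2001, Lemma 4.1] -/
theorem locGradPart_eq_sum_newtonGradPotential (x : EuclideanSpace ℝ (Fin 3)) :
    locGradPart χ u t x =
      ∑ j, newtonGradPotential (EuclideanSpace.single j (1 : ℝ)) (locDivergence χ u t) x •
        EuclideanSpace.single j (1 : ℝ) := by
  set b := EuclideanSpace.basisFun (Fin 3) ℝ with hb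
  have hexp : locGradPart χ u t x = ∑ j, ⟪b j, locGradPart χ u t x⟫ • b j :=
    (b.sum_repr' _).symm
  rw [hexp]
  refine Finset.sum_congr rfl fun j _ => ?_
  have hbj : b j = EuclideanSpace.single j (1 : ℝ) := by
    rw [hb, EuclideanSpace.basisFun_apply]
  rw [hbj, locGradPart_eq, real_inner_comm, gradient, InnerProductSpace.toDual_symm_apply,
    fderiv_locPotential_apply hsol hχ ht]

end Slice

/-! ### Joint regularity and the time derivative -/

section Time

variable (hsol : IsCylinderSolution x₁ δ R u p) (hχ : IsLocCutoff x₁ R χ)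
include hsol hχ

/-- **`(t, x) ↦ v(t, x)` is jointly smooth on `(-δ, R²) × ℝ³`**. [folklore] -/
theorem contDiffOn_uncurry_locVelocity :
    ContDiffOn ℝ ∞ (uncurry (locVelocity χ u)) (Ioo (-δ) (R ^ 2) ×ˢ univ) := by
  intro z hz
  obtain ⟨hzt, -⟩ := hz
  by_cases hx : z.2 ∈ ball x₁ R
  · have h1 : ContDiffWithinAt ℝ ∞ (fun w : ℝ × EuclideanSpace ℝ (Fin 3) => χ w.2)
        (Ioo (-δ) (R ^ 2) ×ˢ univ) z :=
      (hχ.contDiff.comp contDiff_snd).contDiffWithinAt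
    have h2 : ContDiffWithinAt ℝ ∞ (uncurry u) (Ioo (-δ) (R ^ 2) ×ˢ ball x₁ R) z :=
      hsol.smooth_velocity z ⟨hzt, hx⟩
    have h2' : ContDiffWithinAt ℝ ∞ (uncurry u) (Ioo (-δ) (R ^ 2) ×ˢ univ) z := by
      refine (h2.mono_of_mem_nhdsWithin ?_)
      refine mem_nhdsWithin_iff_exists_mem_nhds_inter.2 ⟨univ ×ˢ ball x₁ R,
        prod_mem_nhds univ_mem (isOpen_ball.mem_nhds hx), ?_⟩
      rintro w ⟨⟨-, hw2⟩, hw1, -⟩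
      exact ⟨hw1, hw2⟩
    exact (h1.smul h2').congr (fun w _ => rfl) rfl
  · have hxs := hχ.notMem_tsupport_of_notMem_ball hx
    have hopen : IsOpen ((tsupport χ)ᶜ : Set (EuclideanSpace ℝ (Fin 3))) :=
      (isClosed_tsupport χ).isOpen_compl
    have hev : uncurry (locVelocity χ u) =ᶠ[𝓝 z] fun _ => 0 := by
      filter_upwards [(continuous_snd.isOpen_preimage _ hopen).mem_nhds hxs] with w hw
      simp only [uncurry, locVelocity_apply]
      rw [image_eq_zero_of_notMem_tsupport hw, zero_smul]
    exact (contDiffAt_const.congr_of_eventuallyEq hev).contDiffWithinAt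

/-- **The time derivative of the localised velocity**: at `t ∈ (-δ, R²)` and every `x`,
`s ↦ v(s, x)` has derivative `χ(x) ∂ₜu(t, x)`. [folklore] -/
theorem hasDerivAt_locVelocity {t : ℝ} (ht : t ∈ Ioo (-δ) (R ^ 2)) (x : EuclideanSpace ℝ (Fin 3)) :
    HasDerivAt (fun s => locVelocity χ u s x) (χ x • deriv (fun s => u s x) t) t := by
  by_cases hx : x ∈ ball x₁ R
  · have hdiff : DifferentiableAt ℝ (fun s => u s x) t := by
      have h1 : ContDiffAt ℝ ∞ (uncurry u) (t, x) :=
        hsol.smooth_velocity.contDiffAt ((IsCylinderSolution.isOpen_cylinder x₁ δ R).mem_nhds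
          ⟨ht, hx⟩)
      have h2 : ContDiffAt ℝ ∞ (fun s : ℝ => ((s, x) : ℝ × EuclideanSpace ℝ (Fin 3))) t :=
        contDiffAt_id.prodMk contDiffAt_const
      exact ((h1.comp t h2).differentiableAt (by simp))
    have h := hdiff.hasDerivAt.const_smul (χ x)
    exact h
  · have hxs := hχ.notMem_tsupport_of_notMem_ball hx
    have h0 : χ x = 0 := image_eq_zero_of_notMem_tsupport hxs
    simp only [locVelocity_apply, h0, zero_smul]
    exact hasDerivAt_const t 0

/-- `∂ₜv(t, x) = χ(x) ∂ₜu(t, x)`. [folklore] -/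
theorem deriv_locVelocity {t : ℝ} (ht : t ∈ Ioo (-δ) (R ^ 2)) (x : EuclideanSpace ℝ (Fin 3)) :
    deriv (fun s => locVelocity χ u s x) t = χ x • deriv (fun s => u s x) t :=
  (hasDerivAt_locVelocity hsol hχ ht x).deriv

/-- **The localised momentum equation, pointwise**:
`∂ₜv(t, x) = χ(x) (Δu(t) - (u(t)·∇)u(t) - ∇p(t))(x)` for every `x` (the Navier–Stokes equations
inside the ball; both sides vanish off the support of `χ`). [cite: BradshawGrujicKukavica2015, §4 (4.2)] -/
theorem deriv_locVelocity_eq {t : ℝ} (ht : t ∈ Ioo (-δ) (R ^ 2)) (x : EuclideanSpace ℝ (Fin 3)) :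
    deriv (fun s => locVelocity χ u s x) t =
      χ x • ((Δ (u t)) x - convect (u t) (u t) x - gradient (p t) x) := by
  rw [deriv_locVelocity hsol hχ ht]
  by_cases hx : x ∈ ball x₁ R
  · congr 1
    have h := hsol.momentum t ht x hx
    rw [eq_sub_of_add_eq h]
    abel
  · rw [image_eq_zero_of_notMem_tsupport (hχ.notMem_tsupport_of_notMem_ball hx), zero_smul,
      zero_smul]

end Time

end BGK2015

end Literature.Analysis.FluidPDE
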